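import Mathlib
import Literature.Analysis.Matrix.DetAddDiagonalMinors

/-!
# Route BarrierLever — item `DiagonalPencilCoeff` (stmt-ValiantsHypothesis-19127): the principal-minor
# expansion of the diagonal pencil `det (1 + diag(z) · K)`

For a numeric matrix `K ∈ ℂ^{n×n}` the generating identity

  `det (1 + diag(z₁, …, z_n) · K) = Σ_{T ⊆ [n]} z^T · det K[T]`     (`det_one_add_diagonal_mul`)

holds in `ℂ[z]` (`z^T = ∏_{i ∈ T} z_i`, `K[T]` the principal submatrix), so the coefficient of the
multilinear monomial `z^S` is the principal minor `det K[S]` (**`diagonalPencilCoeff`** = the signature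
of item stmt-ValiantsHypothesis-19127 VERBATIM). Proof: the tree's principal-minor expansion of a
diagonal shift `Literature.Analysis.Matrix.det_add_diagonal_eq_sum_minors` (`det (M + diagonal d) =
Σ_T (∏_{i∉T} d_i) det M[T]`, row-multilinearity) with `M = diag(z) K`, `d = 1`; the principal
submatrix of `diag(z) K` on `T` is `diag(z|_T) K[T]`, of determinant `z^T det K[T]`; and `T ↦ 𝟙_T` is
injective (`indicator_injective`).

Role (cell `valiant-natproofs`, rung V4, planner p1-g8): this is the coefficient identity behind the
universal witness `f_K = det (1 + diag(x, y) K)` for `PartitionMinorsHitByVP` (stmt-19717): the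
partition-matrix minor `[U, W]` of `f_K` is the principal-minor layout matrix `(det K[u_i ⊔ w_j])`
(items `PrincipalMinorLayoutsNonsingular` stmt-19126, `…Suffices` stmt-19133).

WHAT THIS IS NOT: pure linear algebra; nothing here about hitting sets, `PartitionMinorsHitByVP`,
Question 6 / crux stmt-14610 or `VP` vs `VNP`.

References: Horn–Johnson, *Matrix Analysis* §0.8.12 (principal minor sums; the companion of MacMahon's
master theorem `det(I + zK) = Σ_S z^S det K[S]`). [folklore]
-/

-- layout Summits/ValiantsHypothesis/ValiantsHypothesis forces the duplicated namespace component
set_option linter.dupNamespace false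

namespace Summit.ValiantsHypothesis.ValiantsHypothesis.Theorems.BarrierLever.DiagonalPencil

open MvPolynomial Matrix Finset

/-- The exponent vector `𝟙_T = Σ_{i ∈ T} e_i` of the multilinear monomial `z^T`. -/
theorem indicator_apply {n : ℕ} (T : Finset (Fin n)) (i : Fin n) :
    (∑ j ∈ T, Finsupp.single j 1 : Fin n →₀ ℕ) i = if i ∈ T then 1 else 0 := by
  rw [Finsupp.finsetSum_apply]
  simp_rw [Finsupp.single_apply]
  rw [Finset.sum_ite_eq']

/-- `T ↦ 𝟙_T` is injective. -/
theorem indicator_injective {n : ℕ} {T S : Finset (Fin n)}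
    (h : (∑ j ∈ T, Finsupp.single j 1 : Fin n →₀ ℕ) = ∑ j ∈ S, Finsupp.single j 1) : T = S := by
  ext i
  have hi := congrArg (fun m : Fin n →₀ ℕ => m i) h
  simp only [indicator_apply] at hi
  by_cases hT : i ∈ T <;> by_cases hS : i ∈ S <;> simp_all

/-- The principal submatrix of `diag(X) · K` on `T` is `diag(X|_T) · K[T]`. -/
theorem submatrix_diagonal_mul {n : ℕ} (K : Matrix (Fin n) (Fin n) ℂ) (T : Finset (Fin n)) :
    (Matrix.diagonal (fun i : Fin n => (X i : MvPolynomial (Fin n) ℂ)) * K.map C).submatrix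
        (Subtype.val : ↥T → Fin n) (Subtype.val : ↥T → Fin n) =
      Matrix.diagonal (fun a : ↥T => (X a.1 : MvPolynomial (Fin n) ℂ)) *
        (K.submatrix (Subtype.val : ↥T → Fin n) (Subtype.val : ↥T → Fin n)).map C := by
  ext a b
  simp [Matrix.submatrix_apply, Matrix.diagonal_mul]

/-- **Generating identity**: `det (1 + diag(X) K) = Σ_T z^T · det K[T]`. -/
theorem det_one_add_diagonal_mul {n : ℕ} (K : Matrix (Fin n) (Fin n) ℂ) :
    ((1 : Matrix (Fin n) (Fin n) (MvPolynomial (Fin n) ℂ)) +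
        Matrix.diagonal (fun i : Fin n => (X i : MvPolynomial (Fin n) ℂ)) * K.map C).det =
      ∑ T : Finset (Fin n), monomial (∑ j ∈ T, Finsupp.single j 1)
        ((K.submatrix (Subtype.val : ↥T → Fin n) (Subtype.val : ↥T → Fin n)).det) := by
  rw [add_comm, ← Matrix.diagonal_one, Literature.Analysis.Matrix.det_add_diagonal_eq_sum_minors]
  refine Finset.sum_congr rfl fun T _ => ?_
  rw [Finset.prod_const_one, one_mul, submatrix_diagonal_mul, Matrix.det_mul, Matrix.det_diagonal,
    ← RingHom.mapMatrix_apply, ← RingHom.map_det, Finset.prod_coe_sort T (fun i => (X i : MvPolynomial (Fin n) ℂ))]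
  rw [show (∏ i ∈ T, (X i : MvPolynomial (Fin n) ℂ)) = monomial (∑ j ∈ T, Finsupp.single j 1) 1 from by
    rw [monomial_sum_one]; rfl]
  rw [mul_comm, C_mul_monomial, mul_one]

/-- **Item `DiagonalPencilCoeff` (stmt-ValiantsHypothesis-19127), signature verbatim**: the
coefficient of the multilinear monomial `z^S` in `det (1 + diag(z) · K)` is the principal minor
`det K[S]`. -/
theorem diagonalPencilCoeff :
    ∀ (n : ℕ) (K : Matrix (Fin n) (Fin n) ℂ) (S : Finset (Fin n)), MvPolynomial.coeff (∑ i ∈ S, Finsupp.single i 1) ((1 + Matrix.diagonal (fun i : Fin n => (MvPolynomial.X i : MvPolynomial (Fin n) ℂ)) * K.map MvPolynomial.C).det) = (K.submatrix (Subtype.val : ↥S → Fin n) (Subtype.val : ↥S → Fin n)).det := by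
  intro n K S
  classical
  rw [det_one_add_diagonal_mul, coeff_sum]
  simp_rw [coeff_monomial]
  rw [Finset.sum_eq_single S]
  · rw [if_pos rfl]
  · intro T _ hT
    rw [if_neg]
    exact fun h => hT (indicator_injective h)
  · intro h; exact absurd (Finset.mem_univ S) h

end Summit.ValiantsHypothesis.ValiantsHypothesis.Theorems.BarrierLever.DiagonalPencil
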